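import Mathlib
import HarnessLib

/-!
# Route `KLProgramme` — crux K3 ENGINE (stmt-HubbardSuperconductivity-20437) stub (b) conj. 2 «(c-D)² FAMILY TELESCOPE», brick (D5k): UNIFORM BOUNDS
# FOR THE RELATIVE RATE COEFFICIENTS `r_{kℓ}` of the family-increment pair lemma — `r_{kℓ} ≤ Q·Y^{k−ℓ}`, `Y ≥ 1/Λ_m²`, ONE `Q` free of the scale

Cell `gate-hubbard-kl`, seat hubbard-kl-k3c3-p2 (g11); F1-DESIGN §10.  The family piece (`…EngineSliceFamPieceTel`) carries the nested coefficients
`𝔮 → (d, w, o) → R → r` of `…FatMultiplierIncrementRelJetsScale` as abbreviation hypotheses; its eleven thresholds `4C_kρ³ ≤ K_c x^{3−k}`, … ask for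
sizes of the `r_{kℓ}`.  Here, with the atoms dominated by ONE scale variable `Y` (`1/Λ_m ≤ Y`, `1/Λ_m² ≤ Y`, `1 ≤ Y`, `κ = e₀²/Λ_m²`, `ζ ≤ z_c·Y`),
the increment sizes `G_k ≤ g_k` and the EXACT ratios `G_k = γ_k·G₀` (`k = 1,2,3`, `0 < G₀`; in the flow `G₀ = c″U²`, `G_k = Gfr_k U²`), the slot `t ≤ T₀`,
`ε₃₀ ≤ E₀`, `ε₃₁ ≤ E₁`:

* **`famIncr_rates_uniform`** — `∃ Q ≥ 0` depending only on `(T₀, A, ε₂, E₀, E₁, e₀, d, Ba, z_c, g₀…g₃, γ₁…γ₃)` with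
  `r₁₀ ≤ QY`, `r₁₁ ≤ Q`, `r₂₀ ≤ QY²`, `r₂₁ ≤ QY`, `r₂₂ ≤ Q`, `r₃₀ ≤ QY³`, `r₃₁ ≤ QY²`, `r₃₂ ≤ QY`, `r₃₃ ≤ Q` for EVERY instance of the abbreviation system
  (so the same `Q` serves the isotropic family `t = 4 + 2A` and the tangent family `t = t_v ≤ T₀` at every family scale).  Pure bookkeeping. [folklore]
-/

noncomputable section

namespace Summit.HubbardSuperconductivity.HubbardSuperconductivity.Theorems.TorusFourierL2

set_option linter.dupNamespace false -- summit = problem name (single-conjunct summit), D-0017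

set_option maxHeartbeats 4000000 in
/-- **Uniform bounds `r_{kℓ} ≤ Q·Y^{k−ℓ}` for the relative rate coefficients of the family increment** (see the module docstring). [folklore] -/
theorem famIncr_rates_uniform {T₀ A ε₂ E₀ E₁ e₀ d Ba zc g₀ g₁ g₂ g₃ γ₁ γ₂ γ₃ : ℝ} (hT₀ : 0 ≤ T₀) (hA : 0 ≤ A) (hε₂0 : 0 ≤ ε₂) (hE₀ : 0 ≤ E₀)
    (hE₁ : 0 ≤ E₁) (hd : 0 ≤ d) (hBa : 0 ≤ Ba) (hzc : 0 ≤ zc) (hg₀ : 0 ≤ g₀) (hg₁ : 0 ≤ g₁) (hg₂ : 0 ≤ g₂) (hg₃ : 0 ≤ g₃)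
    (hγ₁ : 0 ≤ γ₁) (hγ₂ : 0 ≤ γ₂) (hγ₃ : 0 ≤ γ₃) :
    ∃ Q : ℝ, 0 ≤ Q ∧ ∀ (lam Y t G₀ G₁ G₂ G₃ ζ ε₃₀ ε₃₁ κ 𝔮₁ 𝔮₂ 𝔮₃₀ 𝔮₃₁ d₁ w₁ d₂ w₂ d₃₀ d₃₁ w₃₀ w₃₁ o₁₀ o₁₁ o₂₀ o₂₁ o₂₂ o₃₀ o₃₁ o₃₂ o₃₃
        R₁₀ R₁₁ R₂₀ R₂₁ R₂₂ R₃₀ R₃₁ R₃₂ R₃₃ r₁₀ r₁₁ r₂₀ r₂₁ r₂₂ r₃₀ r₃₁ r₃₂ r₃₃ : ℝ),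
      0 < lam → lam ≤ 1 → 1 ≤ Y → 1 / lam ≤ Y → 1 / lam ^ 2 ≤ Y → 0 ≤ t → t ≤ T₀ →
      0 < G₀ → G₀ ≤ g₀ → G₁ = γ₁ * G₀ → G₂ = γ₂ * G₀ → G₃ = γ₃ * G₀ → G₁ ≤ g₁ → G₂ ≤ g₂ → G₃ ≤ g₃ →
      0 ≤ ζ → ζ ≤ zc * Y → 0 ≤ ε₃₀ → ε₃₀ ≤ E₀ → 0 ≤ ε₃₁ → ε₃₁ ≤ E₁ → κ = e₀ ^ 2 / lam ^ 2 →
      𝔮₁ = 2 * (d * e₀ ^ 2) * t / lam + 9 * (12 * Ba * ζ) →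
      𝔮₂ = (4 * (d * e₀ ^ 4) + 2 * (d * e₀ ^ 2)) * t ^ 2 / lam ^ 2 + 2 * (d * e₀ ^ 2) * (4 + 4 * A) / lam +
        4 * (d * e₀ ^ 2) * t / lam * (9 * (12 * Ba * ζ)) + 9 * ((12 * Ba + 72 * Ba ^ 2) * ζ ^ 2) →
      𝔮₃₀ = (8 * (d * e₀ ^ 6) + 12 * (d * e₀ ^ 4)) * t ^ 3 / lam ^ 3 + (12 * (d * e₀ ^ 4) + 6 * (d * e₀ ^ 2)) * (t * (4 + 4 * A)) / lam ^ 2 +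
        2 * (d * e₀ ^ 2) * ε₃₀ / lam +
        3 * (((4 * (d * e₀ ^ 4) + 2 * (d * e₀ ^ 2)) * t ^ 2 / lam ^ 2 + 2 * (d * e₀ ^ 2) * (4 + 4 * A) / lam) * (9 * (12 * Ba * ζ))) +
        3 * (2 * (d * e₀ ^ 2) * t / lam * (9 * ((12 * Ba + 72 * Ba ^ 2) * ζ ^ 2))) + 9 * ((12 * Ba + 216 * Ba ^ 2) * ζ ^ 3) →
      𝔮₃₁ = 2 * (d * e₀ ^ 2) * ε₃₁ / lam →
      d₁ = 4 * lam * t → w₁ = 2 * (t * G₀ + 2 * lam * (2 * G₁) + G₀ * (2 * G₁)) → d₂ = 2 * (t ^ 2 + 2 * lam * ε₂) →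
      w₂ = 2 * (ε₂ * G₀ + 2 * t * (2 * G₁) + 2 * lam * (4 * G₂) + (2 * G₁) ^ 2 + G₀ * (4 * G₂)) →
      d₃₀ = 2 * (3 * t * ε₂ + 2 * lam * ε₃₀) → d₃₁ = 4 * lam * ε₃₁ →
      w₃₀ = 2 * (ε₃₀ * G₀ + ε₃₁ * G₀ + 3 * ε₂ * (2 * G₁) + 3 * t * (4 * G₂) + 3 * (2 * G₁) * (4 * G₂) + G₀ * (8 * G₃)) → w₃₁ = 4 * lam * (8 * G₃) →
      o₁₀ = t / lam → o₁₁ = 2 * (2 * G₁) / G₀ → o₂₀ = ε₂ / lam + (2 * G₁) ^ 2 / (lam * G₀) → o₂₁ = 2 * t * (2 * G₁) / (lam * G₀) →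
      o₂₂ = 2 * (4 * G₂) / G₀ → o₃₀ = ε₃₀ / lam →
      o₃₁ = ε₃₁ / lam + 3 * ε₂ * (2 * G₁) / (lam * G₀) + 3 * (2 * G₁) * (4 * G₂) / (lam * G₀) → o₃₂ = 3 * t * (4 * G₂) / (lam * G₀) →
      o₃₃ = 2 * (8 * G₃) / G₀ →
      R₁₀ = κ * (d₁ + w₁) + o₁₀ → R₁₁ = o₁₁ →
      R₂₀ = κ ^ 2 * (d₁ + w₁) ^ 2 + κ * (o₁₀ * (2 * d₁ + w₁)) + κ * (d₂ + w₂) + o₂₀ → R₂₁ = κ * (o₁₁ * (2 * d₁ + w₁)) + o₂₁ → R₂₂ = o₂₂ →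
      R₃₀ = κ ^ 3 * (d₁ + w₁) ^ 3 + κ ^ 2 * (o₁₀ * (3 * d₁ ^ 2 + 3 * d₁ * w₁ + w₁ ^ 2)) +
        3 * (κ ^ 2 * ((d₁ + w₁) * (d₂ + w₂)) + κ * (d₁ * o₂₀ + o₁₀ * d₂ + o₁₀ * w₂)) + κ * (d₃₀ + w₃₀) + o₃₀ →
      R₃₁ = κ ^ 2 * (o₁₁ * (3 * d₁ ^ 2 + 3 * d₁ * w₁ + w₁ ^ 2)) + 3 * (κ * (d₁ * o₂₁ + o₁₁ * d₂ + o₁₁ * w₂)) + κ * (d₃₁ + w₃₁) + o₃₁ →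
      R₃₂ = 3 * (κ * (d₁ * o₂₂)) + o₃₂ → R₃₃ = o₃₃ →
      r₁₀ = R₁₀ + 𝔮₁ → r₁₁ = R₁₁ → r₂₀ = R₂₀ + 2 * R₁₀ * 𝔮₁ + 𝔮₂ → r₂₁ = R₂₁ + 2 * R₁₁ * 𝔮₁ → r₂₂ = R₂₂ →
      r₃₀ = R₃₀ + 3 * R₂₀ * 𝔮₁ + 3 * R₁₀ * 𝔮₂ + 𝔮₃₀ → r₃₁ = R₃₁ + 3 * R₂₁ * 𝔮₁ + 3 * R₁₁ * 𝔮₂ + 𝔮₃₁ → r₃₂ = R₃₂ + 3 * R₂₂ * 𝔮₁ → r₃₃ = R₃₃ →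
      r₁₀ ≤ Q * Y ∧ r₁₁ ≤ Q ∧ r₂₀ ≤ Q * Y ^ 2 ∧ r₂₁ ≤ Q * Y ∧ r₂₂ ≤ Q ∧ r₃₀ ≤ Q * Y ^ 3 ∧ r₃₁ ≤ Q * Y ^ 2 ∧ r₃₂ ≤ Q * Y ∧ r₃₃ ≤ Q := by
  -- the scale-free majorants (all nonnegative)
  obtain ⟨q₁, hq₁⟩ : ∃ y : ℝ, y = 2 * (d * e₀ ^ 2) * T₀ + 9 * (12 * Ba * zc) := ⟨_, rfl⟩
  obtain ⟨q₂, hq₂⟩ : ∃ y : ℝ, y = (4 * (d * e₀ ^ 4) + 2 * (d * e₀ ^ 2)) * T₀ ^ 2 + 2 * (d * e₀ ^ 2) * (4 + 4 * A) +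
      4 * (d * e₀ ^ 2) * T₀ * (9 * (12 * Ba * zc)) + 9 * ((12 * Ba + 72 * Ba ^ 2) * zc ^ 2) := ⟨_, rfl⟩
  obtain ⟨q₃₀, hq₃₀⟩ : ∃ y : ℝ, y = (8 * (d * e₀ ^ 6) + 12 * (d * e₀ ^ 4)) * T₀ ^ 3 + (12 * (d * e₀ ^ 4) + 6 * (d * e₀ ^ 2)) * (T₀ * (4 + 4 * A)) +
      2 * (d * e₀ ^ 2) * E₀ + 3 * (((4 * (d * e₀ ^ 4) + 2 * (d * e₀ ^ 2)) * T₀ ^ 2 + 2 * (d * e₀ ^ 2) * (4 + 4 * A)) * (9 * (12 * Ba * zc))) +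
      3 * (2 * (d * e₀ ^ 2) * T₀ * (9 * ((12 * Ba + 72 * Ba ^ 2) * zc ^ 2))) + 9 * ((12 * Ba + 216 * Ba ^ 2) * zc ^ 3) := ⟨_, rfl⟩
  obtain ⟨q₃₁, hq₃₁⟩ : ∃ y : ℝ, y = 2 * (d * e₀ ^ 2) * E₁ := ⟨_, rfl⟩
  obtain ⟨dw₁, hdw₁⟩ : ∃ y : ℝ, y = 4 * T₀ + 2 * (T₀ * g₀ + 2 * (2 * g₁) + g₀ * (2 * g₁)) := ⟨_, rfl⟩
  obtain ⟨dw₂, hdw₂⟩ : ∃ y : ℝ, y = 2 * (T₀ ^ 2 + 2 * ε₂) + 2 * (ε₂ * g₀ + 2 * T₀ * (2 * g₁) + 2 * (4 * g₂) + (2 * g₁) ^ 2 + g₀ * (4 * g₂)) := ⟨_, rfl⟩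
  obtain ⟨dw₃₀, hdw₃₀⟩ : ∃ y : ℝ, y = 2 * (3 * T₀ * ε₂ + 2 * E₀) +
      2 * (E₀ * g₀ + E₁ * g₀ + 3 * ε₂ * (2 * g₁) + 3 * T₀ * (4 * g₂) + 3 * (2 * g₁) * (4 * g₂) + g₀ * (8 * g₃)) := ⟨_, rfl⟩
  obtain ⟨dw₃₁, hdw₃₁⟩ : ∃ y : ℝ, y = 4 * E₁ + 4 * (8 * g₃) := ⟨_, rfl⟩
  obtain ⟨p₁₁, hp₁₁⟩ : ∃ y : ℝ, y = 4 * γ₁ := ⟨_, rfl⟩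
  obtain ⟨p₂₀, hp₂₀⟩ : ∃ y : ℝ, y = ε₂ + 4 * γ₁ ^ 2 * g₀ := ⟨_, rfl⟩
  obtain ⟨p₂₁, hp₂₁⟩ : ∃ y : ℝ, y = 4 * T₀ * γ₁ := ⟨_, rfl⟩
  obtain ⟨p₂₂, hp₂₂⟩ : ∃ y : ℝ, y = 8 * γ₂ := ⟨_, rfl⟩
  obtain ⟨p₃₁, hp₃₁⟩ : ∃ y : ℝ, y = E₁ + 6 * ε₂ * γ₁ + 24 * γ₁ * γ₂ * g₀ := ⟨_, rfl⟩
  obtain ⟨p₃₂, hp₃₂⟩ : ∃ y : ℝ, y = 12 * T₀ * γ₂ := ⟨_, rfl⟩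
  obtain ⟨p₃₃, hp₃₃⟩ : ∃ y : ℝ, y = 16 * γ₃ := ⟨_, rfl⟩
  obtain ⟨P₁₀, hP₁₀⟩ : ∃ y : ℝ, y = e₀ ^ 2 * dw₁ + T₀ := ⟨_, rfl⟩
  obtain ⟨P₂₀, hP₂₀⟩ : ∃ y : ℝ, y = (e₀ ^ 2 * dw₁) ^ 2 + e₀ ^ 2 * (T₀ * (2 * dw₁)) + e₀ ^ 2 * dw₂ + p₂₀ := ⟨_, rfl⟩
  obtain ⟨P₂₁, hP₂₁⟩ : ∃ y : ℝ, y = e₀ ^ 2 * (p₁₁ * (2 * dw₁)) + p₂₁ := ⟨_, rfl⟩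
  obtain ⟨P₃₀, hP₃₀⟩ : ∃ y : ℝ, y = (e₀ ^ 2 * dw₁) ^ 3 + (e₀ ^ 2) ^ 2 * (T₀ * (3 * dw₁ ^ 2)) +
      3 * ((e₀ ^ 2) ^ 2 * (dw₁ * dw₂) + e₀ ^ 2 * (4 * T₀ * p₂₀ + T₀ * dw₂)) + e₀ ^ 2 * dw₃₀ + E₀ := ⟨_, rfl⟩
  obtain ⟨P₃₁, hP₃₁⟩ : ∃ y : ℝ, y = (e₀ ^ 2) ^ 2 * (p₁₁ * (3 * dw₁ ^ 2)) + 3 * (e₀ ^ 2 * (4 * T₀ * p₂₁ + p₁₁ * dw₂)) + e₀ ^ 2 * dw₃₁ + p₃₁ := ⟨_, rfl⟩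
  obtain ⟨P₃₂, hP₃₂⟩ : ∃ y : ℝ, y = 3 * (e₀ ^ 2 * (4 * T₀ * p₂₂)) + p₃₂ := ⟨_, rfl⟩
  have hq₁0 : 0 ≤ q₁ := by rw [hq₁]; positivity
  have hq₂0 : 0 ≤ q₂ := by rw [hq₂]; positivity
  obtain ⟨hq₃₀0, hq₃₁0⟩ : 0 ≤ q₃₀ ∧ 0 ≤ q₃₁ := ⟨by rw [hq₃₀]; positivity, by rw [hq₃₁]; positivity⟩
  have hdw₁0 : 0 ≤ dw₁ := by rw [hdw₁]; positivity
  have hdw₂0 : 0 ≤ dw₂ := by rw [hdw₂]; positivity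
  have hdw₃₀0 : 0 ≤ dw₃₀ := by rw [hdw₃₀]; positivity
  have hdw₃₁0 : 0 ≤ dw₃₁ := by rw [hdw₃₁]; positivity
  have hp₁₁0 : 0 ≤ p₁₁ := by rw [hp₁₁]; positivity
  have hp₂₀0 : 0 ≤ p₂₀ := by rw [hp₂₀]; positivity
  have hp₂₁0 : 0 ≤ p₂₁ := by rw [hp₂₁]; positivity
  have hp₂₂0 : 0 ≤ p₂₂ := by rw [hp₂₂]; positivity
  have hp₃₁0 : 0 ≤ p₃₁ := by rw [hp₃₁]; positivity
  have hp₃₂0 : 0 ≤ p₃₂ := by rw [hp₃₂]; positivity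
  have hp₃₃0 : 0 ≤ p₃₃ := by rw [hp₃₃]; positivity
  have hP₁₀0 : 0 ≤ P₁₀ := by rw [hP₁₀]; positivity
  have hP₂₀0 : 0 ≤ P₂₀ := by rw [hP₂₀]; positivity
  have hP₂₁0 : 0 ≤ P₂₁ := by rw [hP₂₁]; positivity
  have hP₃₀0 : 0 ≤ P₃₀ := by rw [hP₃₀]; positivity
  have hP₃₁0 : 0 ≤ P₃₁ := by rw [hP₃₁]; positivity
  have hP₃₂0 : 0 ≤ P₃₂ := by rw [hP₃₂]; positivity
  refine ⟨(P₁₀ + q₁) + p₁₁ + (P₂₀ + 2 * P₁₀ * q₁ + q₂) + (P₂₁ + 2 * p₁₁ * q₁) + p₂₂ + (P₃₀ + 3 * P₂₀ * q₁ + 3 * P₁₀ * q₂ + q₃₀) +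
      (P₃₁ + 3 * P₂₁ * q₁ + 3 * p₁₁ * q₂ + q₃₁) + (P₃₂ + 3 * p₂₂ * q₁) + p₃₃, by positivity, ?_⟩
  intro lam Y t G₀ G₁ G₂ G₃ ζ ε₃₀ ε₃₁ κ 𝔮₁ 𝔮₂ 𝔮₃₀ 𝔮₃₁ d₁ w₁ d₂ w₂ d₃₀ d₃₁ w₃₀ w₃₁ o₁₀ o₁₁ o₂₀ o₂₁ o₂₂ o₃₀ o₃₁ o₃₂ o₃₃
    R₁₀ R₁₁ R₂₀ R₂₁ R₂₂ R₃₀ R₃₁ R₃₂ R₃₃ r₁₀ r₁₁ r₂₀ r₂₁ r₂₂ r₃₀ r₃₁ r₃₂ r₃₃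
    hlam hlam1 hY1 hY hY2 ht0 htT hG₀ hG₀g hG₁γ hG₂γ hG₃γ hG₁g hG₂g hG₃g hζ0 hζ hε₃₀0 hε₃₀E hε₃₁0 hε₃₁E hκ
    h𝔮₁ h𝔮₂ h𝔮₃₀ h𝔮₃₁ hd₁ hw₁ hd₂ hw₂ hd₃₀ hd₃₁ hw₃₀ hw₃₁ ho₁₀ ho₁₁ ho₂₀ ho₂₁ ho₂₂ ho₃₀ ho₃₁ ho₃₂ ho₃₃
    hR₁₀ hR₁₁ hR₂₀ hR₂₁ hR₂₂ hR₃₀ hR₃₁ hR₃₂ hR₃₃ hr₁₀ hr₁₁ hr₂₀ hr₂₁ hr₂₂ hr₃₀ hr₃₁ hr₃₂ hr₃₃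
  -- atoms
  have hY0 : 0 ≤ Y := zero_le_one.trans hY1
  have hYY : Y ≤ Y ^ 2 := by nlinarith only [hY1]
  have hYY3 : Y ≤ Y ^ 3 := by nlinarith only [hY1, hYY]
  have hY2Y3 : Y ^ 2 ≤ Y ^ 3 := by nlinarith only [hY1, hY0]
  have hG₀0 : 0 ≤ G₀ := hG₀.le
  have hG₁0 : 0 ≤ G₁ := by rw [hG₁γ]; positivity
  have hG₂0 : 0 ≤ G₂ := by rw [hG₂γ]; positivity
  have hG₃0 : 0 ≤ G₃ := by rw [hG₃γ]; positivity
  have hκ0 : 0 ≤ κ := by rw [hκ]; positivity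
  have hκY : κ ≤ e₀ ^ 2 * Y := by rw [hκ, div_eq_mul_one_div]; exact mul_le_mul_of_nonneg_left hY2 (sq_nonneg _)
  have hlY : ∀ {a : ℝ}, 0 ≤ a → a / lam ≤ a * Y := fun {a} ha => by rw [div_eq_mul_one_div]; exact mul_le_mul_of_nonneg_left hY ha
  have hlY2 : ∀ {a : ℝ}, 0 ≤ a → a / lam ^ 2 ≤ a * Y := fun {a} ha => by rw [div_eq_mul_one_div]; exact mul_le_mul_of_nonneg_left hY2 ha
  have hlY3 : ∀ {a : ℝ}, 0 ≤ a → a / lam ^ 3 ≤ a * Y ^ 2 := fun {a} ha => by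
    have e : a / lam ^ 3 = a * ((1 / lam) * (1 / lam ^ 2)) := by field_simp
    have h2 : (1 / lam) * (1 / lam ^ 2) ≤ Y * Y := mul_le_mul hY hY2 (by positivity) hY0
    rw [e, show Y ^ 2 = Y * Y from pow_two Y]; exact mul_le_mul_of_nonneg_left h2 ha
  -- the `𝔮`'s
  have hζY : ζ ≤ zc * Y := hζ
  have hB𝔮₁ : 𝔮₁ ≤ q₁ * Y := by
    rw [h𝔮₁, hq₁]
    have t1 : 2 * (d * e₀ ^ 2) * t / lam ≤ 2 * (d * e₀ ^ 2) * T₀ * Y :=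
      (hlY (by positivity)).trans (by gcongr)
    have t2 : 9 * (12 * Ba * ζ) ≤ 9 * (12 * Ba * zc) * Y := by nlinarith only [hζY, hBa]
    nlinarith only [t1, t2]
  have hB𝔮₂ : 𝔮₂ ≤ q₂ * Y ^ 2 := by
    rw [h𝔮₂, hq₂]
    have t1 : (4 * (d * e₀ ^ 4) + 2 * (d * e₀ ^ 2)) * t ^ 2 / lam ^ 2 ≤ (4 * (d * e₀ ^ 4) + 2 * (d * e₀ ^ 2)) * T₀ ^ 2 * Y ^ 2 :=
      (hlY2 (by positivity)).trans ((mul_le_mul_of_nonneg_left hYY (by positivity)).trans' (by gcongr))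
    have t2 : 2 * (d * e₀ ^ 2) * (4 + 4 * A) / lam ≤ 2 * (d * e₀ ^ 2) * (4 + 4 * A) * Y ^ 2 :=
      (hlY (by positivity)).trans (mul_le_mul_of_nonneg_left hYY (by positivity))
    have t3a : 4 * (d * e₀ ^ 2) * t / lam ≤ 4 * (d * e₀ ^ 2) * T₀ * Y := (hlY (by positivity)).trans (by gcongr)
    have t3 : 4 * (d * e₀ ^ 2) * t / lam * (9 * (12 * Ba * ζ)) ≤ 4 * (d * e₀ ^ 2) * T₀ * (9 * (12 * Ba * zc)) * Y ^ 2 := by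
      calc _ ≤ (4 * (d * e₀ ^ 2) * T₀ * Y) * (9 * (12 * Ba * (zc * Y))) := mul_le_mul t3a (by gcongr) (by positivity) (by positivity)
        _ = _ := by ring
    have t4 : 9 * ((12 * Ba + 72 * Ba ^ 2) * ζ ^ 2) ≤ 9 * ((12 * Ba + 72 * Ba ^ 2) * zc ^ 2) * Y ^ 2 := by
      have : ζ ^ 2 ≤ (zc * Y) ^ 2 := pow_le_pow_left₀ hζ0 hζY 2
      nlinarith only [this, hBa, sq_nonneg Ba]
    nlinarith only [t1, t2, t3, t4]
  have hB𝔮₃₀ : 𝔮₃₀ ≤ q₃₀ * Y ^ 3 := by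
    rw [h𝔮₃₀, hq₃₀]
    have t1 : (8 * (d * e₀ ^ 6) + 12 * (d * e₀ ^ 4)) * t ^ 3 / lam ^ 3 ≤ (8 * (d * e₀ ^ 6) + 12 * (d * e₀ ^ 4)) * T₀ ^ 3 * Y ^ 3 :=
      (hlY3 (by positivity)).trans ((mul_le_mul_of_nonneg_left hY2Y3 (by positivity)).trans' (by gcongr))
    have t2 : (12 * (d * e₀ ^ 4) + 6 * (d * e₀ ^ 2)) * (t * (4 + 4 * A)) / lam ^ 2 ≤ (12 * (d * e₀ ^ 4) + 6 * (d * e₀ ^ 2)) * (T₀ * (4 + 4 * A)) * Y ^ 3 :=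
      (hlY2 (by positivity)).trans ((mul_le_mul_of_nonneg_left hYY3 (by positivity)).trans' (by gcongr))
    have t3 : 2 * (d * e₀ ^ 2) * ε₃₀ / lam ≤ 2 * (d * e₀ ^ 2) * E₀ * Y ^ 3 :=
      (hlY (by positivity)).trans ((mul_le_mul_of_nonneg_left hYY3 (by positivity)).trans' (by gcongr))
    have t4a : (4 * (d * e₀ ^ 4) + 2 * (d * e₀ ^ 2)) * t ^ 2 / lam ^ 2 + 2 * (d * e₀ ^ 2) * (4 + 4 * A) / lam ≤
        ((4 * (d * e₀ ^ 4) + 2 * (d * e₀ ^ 2)) * T₀ ^ 2 + 2 * (d * e₀ ^ 2) * (4 + 4 * A)) * Y ^ 2 := by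
      have u1 : (4 * (d * e₀ ^ 4) + 2 * (d * e₀ ^ 2)) * t ^ 2 / lam ^ 2 ≤ (4 * (d * e₀ ^ 4) + 2 * (d * e₀ ^ 2)) * T₀ ^ 2 * Y ^ 2 :=
        (hlY2 (by positivity)).trans ((mul_le_mul_of_nonneg_left hYY (by positivity)).trans' (by gcongr))
      have u2 : 2 * (d * e₀ ^ 2) * (4 + 4 * A) / lam ≤ 2 * (d * e₀ ^ 2) * (4 + 4 * A) * Y ^ 2 :=
        (hlY (by positivity)).trans (mul_le_mul_of_nonneg_left hYY (by positivity))
      nlinarith only [u1, u2]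
    have t4 : 3 * (((4 * (d * e₀ ^ 4) + 2 * (d * e₀ ^ 2)) * t ^ 2 / lam ^ 2 + 2 * (d * e₀ ^ 2) * (4 + 4 * A) / lam) * (9 * (12 * Ba * ζ))) ≤
        3 * (((4 * (d * e₀ ^ 4) + 2 * (d * e₀ ^ 2)) * T₀ ^ 2 + 2 * (d * e₀ ^ 2) * (4 + 4 * A)) * (9 * (12 * Ba * zc))) * Y ^ 3 := by
      have := mul_le_mul t4a (show 9 * (12 * Ba * ζ) ≤ 9 * (12 * Ba * (zc * Y)) by gcongr) (by positivity) (by positivity)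
      calc _ ≤ 3 * ((((4 * (d * e₀ ^ 4) + 2 * (d * e₀ ^ 2)) * T₀ ^ 2 + 2 * (d * e₀ ^ 2) * (4 + 4 * A)) * Y ^ 2) * (9 * (12 * Ba * (zc * Y)))) :=
            mul_le_mul_of_nonneg_left this (by norm_num)
        _ = _ := by ring
    have t5a : 2 * (d * e₀ ^ 2) * t / lam ≤ 2 * (d * e₀ ^ 2) * T₀ * Y := (hlY (by positivity)).trans (by gcongr)
    have t5 : 3 * (2 * (d * e₀ ^ 2) * t / lam * (9 * ((12 * Ba + 72 * Ba ^ 2) * ζ ^ 2))) ≤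
        3 * (2 * (d * e₀ ^ 2) * T₀ * (9 * ((12 * Ba + 72 * Ba ^ 2) * zc ^ 2))) * Y ^ 3 := by
      have hz2 : ζ ^ 2 ≤ (zc * Y) ^ 2 := pow_le_pow_left₀ hζ0 hζY 2
      have := mul_le_mul t5a (show 9 * ((12 * Ba + 72 * Ba ^ 2) * ζ ^ 2) ≤ 9 * ((12 * Ba + 72 * Ba ^ 2) * (zc * Y) ^ 2) by gcongr)
        (by positivity) (by positivity)
      calc _ ≤ 3 * ((2 * (d * e₀ ^ 2) * T₀ * Y) * (9 * ((12 * Ba + 72 * Ba ^ 2) * (zc * Y) ^ 2))) := mul_le_mul_of_nonneg_left this (by norm_num)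
        _ = _ := by ring
    have t6 : 9 * ((12 * Ba + 216 * Ba ^ 2) * ζ ^ 3) ≤ 9 * ((12 * Ba + 216 * Ba ^ 2) * zc ^ 3) * Y ^ 3 := by
      have hz3 : ζ ^ 3 ≤ (zc * Y) ^ 3 := pow_le_pow_left₀ hζ0 hζY 3
      calc _ ≤ 9 * ((12 * Ba + 216 * Ba ^ 2) * (zc * Y) ^ 3) := by gcongr
        _ = _ := by ring
    nlinarith only [t1, t2, t3, t4, t5, t6]
  have hB𝔮₃₁ : 𝔮₃₁ ≤ q₃₁ * Y := by
    rw [h𝔮₃₁, hq₃₁]; exact (hlY (by positivity)).trans (by gcongr)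
  have h𝔮₁0 : 0 ≤ 𝔮₁ := by rw [h𝔮₁]; positivity
  have h𝔮₂0 : 0 ≤ 𝔮₂ := by rw [h𝔮₂]; positivity
  -- the `d, w` atoms
  have hdw₁b : d₁ + w₁ ≤ dw₁ := by
    rw [hd₁, hw₁, hdw₁]
    have u1 : 4 * lam * t ≤ 4 * T₀ := by nlinarith only [hlam1, htT, ht0, hlam]
    have u2 : 2 * lam * (2 * G₁) ≤ 2 * (2 * g₁) := by nlinarith only [hlam1, hG₁g, hG₁0, hlam]
    have u3 : t * G₀ ≤ T₀ * g₀ := mul_le_mul htT hG₀g hG₀0 hT₀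
    have u4 : G₀ * (2 * G₁) ≤ g₀ * (2 * g₁) := mul_le_mul hG₀g (by linarith) (by positivity) hg₀
    linarith
  have hd₁0 : 0 ≤ d₁ := by rw [hd₁]; positivity
  have hw₁0 : 0 ≤ w₁ := by rw [hw₁]; positivity
  have hd₁b : d₁ ≤ 4 * T₀ := by rw [hd₁]; nlinarith only [hlam1, htT, ht0, hlam]
  have h2dw₁ : 2 * d₁ + w₁ ≤ 2 * dw₁ := by linarith
  have h3dw₁ : 3 * d₁ ^ 2 + 3 * d₁ * w₁ + w₁ ^ 2 ≤ 3 * dw₁ ^ 2 := by nlinarith only [hdw₁b, hd₁0, hw₁0]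
  have hdw₂b : d₂ + w₂ ≤ dw₂ := by
    rw [hd₂, hw₂, hdw₂]
    have u1 : 2 * lam * ε₂ ≤ 2 * ε₂ := by nlinarith only [hlam1, hε₂0]
    have u2 : t ^ 2 ≤ T₀ ^ 2 := pow_le_pow_left₀ ht0 htT 2
    have u3 : ε₂ * G₀ ≤ ε₂ * g₀ := mul_le_mul_of_nonneg_left hG₀g hε₂0
    have u4 : 2 * t * (2 * G₁) ≤ 2 * T₀ * (2 * g₁) := mul_le_mul (by linarith) (by linarith) (by positivity) (by positivity)
    have u5 : 2 * lam * (4 * G₂) ≤ 2 * (4 * g₂) := by nlinarith only [hlam1, hG₂g, hG₂0, hlam]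
    have u6 : (2 * G₁) ^ 2 ≤ (2 * g₁) ^ 2 := pow_le_pow_left₀ (by positivity) (by linarith) 2
    have u7 : G₀ * (4 * G₂) ≤ g₀ * (4 * g₂) := mul_le_mul hG₀g (by linarith) (by positivity) hg₀
    linarith
  have hdw₂0 : 0 ≤ d₂ + w₂ := by rw [hd₂, hw₂]; positivity
  have hdw₃₀b : d₃₀ + w₃₀ ≤ dw₃₀ := by
    rw [hd₃₀, hw₃₀, hdw₃₀]
    have u1 : 3 * t * ε₂ ≤ 3 * T₀ * ε₂ := by nlinarith only [htT, hε₂0]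
    have u2 : 2 * lam * ε₃₀ ≤ 2 * E₀ := by nlinarith only [hlam1, hε₃₀E, hε₃₀0, hlam]
    have u3 : ε₃₀ * G₀ ≤ E₀ * g₀ := mul_le_mul hε₃₀E hG₀g hG₀0 hE₀
    have u4 : ε₃₁ * G₀ ≤ E₁ * g₀ := mul_le_mul hε₃₁E hG₀g hG₀0 hE₁
    have u5 : 3 * ε₂ * (2 * G₁) ≤ 3 * ε₂ * (2 * g₁) := by nlinarith only [hG₁g, hε₂0]
    have u6 : 3 * t * (4 * G₂) ≤ 3 * T₀ * (4 * g₂) := mul_le_mul (by linarith) (by linarith) (by positivity) (by positivity)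
    have u7 : 3 * (2 * G₁) * (4 * G₂) ≤ 3 * (2 * g₁) * (4 * g₂) := mul_le_mul (by linarith) (by linarith) (by positivity) (by positivity)
    have u8 : G₀ * (8 * G₃) ≤ g₀ * (8 * g₃) := mul_le_mul hG₀g (by linarith) (by positivity) hg₀
    linarith
  have hdw₃₀0 : 0 ≤ d₃₀ + w₃₀ := by rw [hd₃₀, hw₃₀]; positivity
  have hdw₃₁b : d₃₁ + w₃₁ ≤ dw₃₁ := by
    rw [hd₃₁, hw₃₁, hdw₃₁]
    have u1 : 4 * lam * ε₃₁ ≤ 4 * E₁ := by nlinarith only [hlam1, hε₃₁E, hε₃₁0, hlam]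
    have u2 : 4 * lam * (8 * G₃) ≤ 4 * (8 * g₃) := by nlinarith only [hlam1, hG₃g, hG₃0, hlam]
    linarith
  have hdw₃₁0 : 0 ≤ d₃₁ + w₃₁ := by rw [hd₃₁, hw₃₁]; positivity
  -- the `o` atoms (exact ratios)
  have hG₀ne : G₀ ≠ 0 := hG₀.ne'
  have ho₁₀b : o₁₀ ≤ T₀ * Y := by rw [ho₁₀]; exact (hlY ht0).trans (by gcongr)
  have ho₁₀0 : 0 ≤ o₁₀ := by rw [ho₁₀]; positivity
  have ho₁₁e : o₁₁ = p₁₁ := by rw [ho₁₁, hp₁₁, hG₁γ]; field_simp; ring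
  have ho₂₀b : o₂₀ ≤ p₂₀ * Y := by
    rw [ho₂₀, hp₂₀]
    have e : (2 * G₁) ^ 2 / (lam * G₀) = (4 * γ₁ ^ 2 * G₀) / lam := by rw [hG₁γ]; field_simp; ring
    rw [e]
    have u1 := hlY hε₂0
    have u2 : 4 * γ₁ ^ 2 * G₀ / lam ≤ 4 * γ₁ ^ 2 * g₀ * Y := (hlY (by positivity)).trans (by gcongr)
    linarith
  have ho₂₀0 : 0 ≤ o₂₀ := by rw [ho₂₀]; positivity
  have ho₂₁b : o₂₁ ≤ p₂₁ * Y := by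
    rw [ho₂₁, hp₂₁]
    have e : 2 * t * (2 * G₁) / (lam * G₀) = (4 * t * γ₁) / lam := by rw [hG₁γ]; field_simp; ring
    rw [e]; exact (hlY (by positivity)).trans (by gcongr)
  have ho₂₁0 : 0 ≤ o₂₁ := by rw [ho₂₁]; positivity
  have ho₂₂e : o₂₂ = p₂₂ := by rw [ho₂₂, hp₂₂, hG₂γ]; field_simp; ring
  have ho₃₀b : o₃₀ ≤ E₀ * Y := by rw [ho₃₀]; exact (hlY hε₃₀0).trans (by gcongr)
  have ho₃₀0 : 0 ≤ o₃₀ := by rw [ho₃₀]; positivity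
  have ho₃₁b : o₃₁ ≤ p₃₁ * Y := by
    rw [ho₃₁, hp₃₁]
    have e1 : 3 * ε₂ * (2 * G₁) / (lam * G₀) = (6 * ε₂ * γ₁) / lam := by rw [hG₁γ]; field_simp; ring
    have e2 : 3 * (2 * G₁) * (4 * G₂) / (lam * G₀) = (24 * γ₁ * γ₂ * G₀) / lam := by rw [hG₁γ, hG₂γ]; field_simp; ring
    rw [e1, e2]
    have u1 : ε₃₁ / lam ≤ E₁ * Y := (hlY hε₃₁0).trans (by gcongr)
    have u2 : 6 * ε₂ * γ₁ / lam ≤ 6 * ε₂ * γ₁ * Y := hlY (by positivity)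
    have u3 : 24 * γ₁ * γ₂ * G₀ / lam ≤ 24 * γ₁ * γ₂ * g₀ * Y := (hlY (by positivity)).trans (by gcongr)
    linarith
  have ho₃₂b : o₃₂ ≤ p₃₂ * Y := by
    rw [ho₃₂, hp₃₂]
    have e : 3 * t * (4 * G₂) / (lam * G₀) = (12 * t * γ₂) / lam := by rw [hG₂γ]; field_simp; ring
    rw [e]; exact (hlY (by positivity)).trans (by gcongr)
  have ho₃₃e : o₃₃ = p₃₃ := by rw [ho₃₃, hp₃₃, hG₃γ]; field_simp; ring
  -- the `R`'s
  have hκdw : κ * (d₁ + w₁) ≤ e₀ ^ 2 * dw₁ * Y := by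
    calc κ * (d₁ + w₁) ≤ (e₀ ^ 2 * Y) * dw₁ := mul_le_mul hκY hdw₁b (by positivity) (by positivity)
      _ = e₀ ^ 2 * dw₁ * Y := by ring
  have hκdw0 : 0 ≤ κ * (d₁ + w₁) := by positivity
  have hBR₁₀ : R₁₀ ≤ P₁₀ * Y := by rw [hR₁₀, hP₁₀]; nlinarith only [hκdw, ho₁₀b]
  have hR₁₀0 : 0 ≤ R₁₀ := by rw [hR₁₀]; positivity
  have hBR₂₀ : R₂₀ ≤ P₂₀ * Y ^ 2 := by
    rw [hR₂₀, hP₂₀]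
    have t1 : κ ^ 2 * (d₁ + w₁) ^ 2 ≤ (e₀ ^ 2 * dw₁) ^ 2 * Y ^ 2 := by
      rw [← mul_pow, ← mul_pow]; exact pow_le_pow_left₀ hκdw0 hκdw 2
    have t2 : κ * (o₁₀ * (2 * d₁ + w₁)) ≤ e₀ ^ 2 * (T₀ * (2 * dw₁)) * Y ^ 2 := by
      calc κ * (o₁₀ * (2 * d₁ + w₁)) ≤ (e₀ ^ 2 * Y) * ((T₀ * Y) * (2 * dw₁)) :=
            mul_le_mul hκY (mul_le_mul ho₁₀b h2dw₁ (by positivity) (by positivity)) (by positivity) (by positivity)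
        _ = _ := by ring
    have t3 : κ * (d₂ + w₂) ≤ e₀ ^ 2 * dw₂ * Y ^ 2 := by
      calc κ * (d₂ + w₂) ≤ (e₀ ^ 2 * Y) * dw₂ := mul_le_mul hκY hdw₂b hdw₂0 (by positivity)
        _ = e₀ ^ 2 * dw₂ * Y := by ring
        _ ≤ e₀ ^ 2 * dw₂ * Y ^ 2 := mul_le_mul_of_nonneg_left hYY (by positivity)
    have t4 : o₂₀ ≤ p₂₀ * Y ^ 2 := ho₂₀b.trans (mul_le_mul_of_nonneg_left hYY hp₂₀0)
    nlinarith only [t1, t2, t3, t4]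
  have hR₂₀0 : 0 ≤ R₂₀ := by rw [hR₂₀]; positivity
  have hBR₂₁ : R₂₁ ≤ P₂₁ * Y := by
    rw [hR₂₁, hP₂₁, ho₁₁e]
    have t1 : κ * (p₁₁ * (2 * d₁ + w₁)) ≤ (e₀ ^ 2 * Y) * (p₁₁ * (2 * dw₁)) :=
      mul_le_mul hκY (mul_le_mul_of_nonneg_left h2dw₁ hp₁₁0) (by positivity) (by positivity)
    nlinarith only [t1, ho₂₁b]
  have hR₂₁0 : 0 ≤ R₂₁ := by rw [hR₂₁, ho₁₁e]; positivity
  have hBR₃₀ : R₃₀ ≤ P₃₀ * Y ^ 3 := by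
    rw [hR₃₀, hP₃₀]
    have t1 : κ ^ 3 * (d₁ + w₁) ^ 3 ≤ (e₀ ^ 2 * dw₁) ^ 3 * Y ^ 3 := by
      rw [← mul_pow, ← mul_pow]; exact pow_le_pow_left₀ hκdw0 hκdw 3
    have t2 : κ ^ 2 * (o₁₀ * (3 * d₁ ^ 2 + 3 * d₁ * w₁ + w₁ ^ 2)) ≤ (e₀ ^ 2) ^ 2 * (T₀ * (3 * dw₁ ^ 2)) * Y ^ 3 := by
      have hκ2 : κ ^ 2 ≤ (e₀ ^ 2 * Y) ^ 2 := pow_le_pow_left₀ hκ0 hκY 2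
      calc _ ≤ (e₀ ^ 2 * Y) ^ 2 * ((T₀ * Y) * (3 * dw₁ ^ 2)) :=
            mul_le_mul hκ2 (mul_le_mul ho₁₀b h3dw₁ (by positivity) (by positivity)) (by positivity) (by positivity)
        _ = _ := by ring
    have t3 : κ ^ 2 * ((d₁ + w₁) * (d₂ + w₂)) ≤ (e₀ ^ 2) ^ 2 * (dw₁ * dw₂) * Y ^ 3 := by
      have hκ2 : κ ^ 2 ≤ (e₀ ^ 2 * Y) ^ 2 := pow_le_pow_left₀ hκ0 hκY 2
      calc _ ≤ (e₀ ^ 2 * Y) ^ 2 * (dw₁ * dw₂) :=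
            mul_le_mul hκ2 (mul_le_mul hdw₁b hdw₂b hdw₂0 hdw₁0) (by positivity) (by positivity)
        _ = (e₀ ^ 2) ^ 2 * (dw₁ * dw₂) * Y ^ 2 := by ring
        _ ≤ _ := mul_le_mul_of_nonneg_left hY2Y3 (by positivity)
    have t4 : κ * (d₁ * o₂₀ + o₁₀ * d₂ + o₁₀ * w₂) ≤ e₀ ^ 2 * (4 * T₀ * p₂₀ + T₀ * dw₂) * Y ^ 3 := by
      have u1 : d₁ * o₂₀ ≤ 4 * T₀ * (p₂₀ * Y) := mul_le_mul hd₁b ho₂₀b ho₂₀0 (by positivity)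
      have u2 : o₁₀ * d₂ + o₁₀ * w₂ ≤ (T₀ * Y) * dw₂ := by
        rw [← mul_add]; exact mul_le_mul ho₁₀b hdw₂b hdw₂0 (by positivity)
      have u3 : d₁ * o₂₀ + o₁₀ * d₂ + o₁₀ * w₂ ≤ (4 * T₀ * p₂₀ + T₀ * dw₂) * Y := by nlinarith only [u1, u2]
      calc _ ≤ (e₀ ^ 2 * Y) * ((4 * T₀ * p₂₀ + T₀ * dw₂) * Y) :=
            mul_le_mul hκY u3 (by rw [ho₂₀, ho₁₀, hd₁, hd₂, hw₂]; positivity) (by positivity)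
        _ = e₀ ^ 2 * (4 * T₀ * p₂₀ + T₀ * dw₂) * Y ^ 2 := by ring
        _ ≤ _ := mul_le_mul_of_nonneg_left hY2Y3 (by positivity)
    have t5 : κ * (d₃₀ + w₃₀) ≤ e₀ ^ 2 * dw₃₀ * Y ^ 3 := by
      calc κ * (d₃₀ + w₃₀) ≤ (e₀ ^ 2 * Y) * dw₃₀ := mul_le_mul hκY hdw₃₀b hdw₃₀0 (by positivity)
        _ = e₀ ^ 2 * dw₃₀ * Y := by ring
        _ ≤ _ := mul_le_mul_of_nonneg_left hYY3 (by positivity)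
    have t6 : o₃₀ ≤ E₀ * Y ^ 3 := ho₃₀b.trans (mul_le_mul_of_nonneg_left hYY3 hE₀)
    nlinarith only [t1, t2, t3, t4, t5, t6]
  have hBR₃₁ : R₃₁ ≤ P₃₁ * Y ^ 2 := by
    rw [hR₃₁, hP₃₁, ho₁₁e]
    have t1 : κ ^ 2 * (p₁₁ * (3 * d₁ ^ 2 + 3 * d₁ * w₁ + w₁ ^ 2)) ≤ (e₀ ^ 2) ^ 2 * (p₁₁ * (3 * dw₁ ^ 2)) * Y ^ 2 := by
      have hκ2 : κ ^ 2 ≤ (e₀ ^ 2 * Y) ^ 2 := pow_le_pow_left₀ hκ0 hκY 2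
      calc _ ≤ (e₀ ^ 2 * Y) ^ 2 * (p₁₁ * (3 * dw₁ ^ 2)) :=
            mul_le_mul hκ2 (mul_le_mul_of_nonneg_left h3dw₁ hp₁₁0) (by positivity) (by positivity)
        _ = _ := by ring
    have t2 : κ * (d₁ * o₂₁ + p₁₁ * d₂ + p₁₁ * w₂) ≤ e₀ ^ 2 * (4 * T₀ * p₂₁ + p₁₁ * dw₂) * Y ^ 2 := by
      have u1 : d₁ * o₂₁ ≤ 4 * T₀ * (p₂₁ * Y) := mul_le_mul hd₁b ho₂₁b ho₂₁0 (by positivity)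
      have u2 : p₁₁ * d₂ + p₁₁ * w₂ ≤ p₁₁ * dw₂ := by rw [← mul_add]; exact mul_le_mul_of_nonneg_left hdw₂b hp₁₁0
      have u3 : d₁ * o₂₁ + p₁₁ * d₂ + p₁₁ * w₂ ≤ (4 * T₀ * p₂₁ + p₁₁ * dw₂) * Y := by
        have : p₁₁ * dw₂ ≤ p₁₁ * dw₂ * Y := le_mul_of_one_le_right (by positivity) hY1
        nlinarith only [u1, u2, this]
      calc _ ≤ (e₀ ^ 2 * Y) * ((4 * T₀ * p₂₁ + p₁₁ * dw₂) * Y) :=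
            mul_le_mul hκY u3 (by rw [ho₂₁, hd₁, hd₂, hw₂]; positivity) (by positivity)
        _ = _ := by ring
    have t3 : κ * (d₃₁ + w₃₁) ≤ e₀ ^ 2 * dw₃₁ * Y ^ 2 := by
      calc κ * (d₃₁ + w₃₁) ≤ (e₀ ^ 2 * Y) * dw₃₁ := mul_le_mul hκY hdw₃₁b hdw₃₁0 (by positivity)
        _ = e₀ ^ 2 * dw₃₁ * Y := by ring
        _ ≤ _ := mul_le_mul_of_nonneg_left hYY (by positivity)
    have t4 : o₃₁ ≤ p₃₁ * Y ^ 2 := ho₃₁b.trans (mul_le_mul_of_nonneg_left hYY hp₃₁0)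
    nlinarith only [t1, t2, t3, t4]
  have hBR₃₂ : R₃₂ ≤ P₃₂ * Y := by
    rw [hR₃₂, hP₃₂, ho₂₂e]
    have t1 : κ * (d₁ * p₂₂) ≤ (e₀ ^ 2 * Y) * (4 * T₀ * p₂₂) :=
      mul_le_mul hκY (mul_le_mul_of_nonneg_right hd₁b hp₂₂0) (by positivity) (by positivity)
    nlinarith only [t1, ho₃₂b]
  -- the `r`'s
  have hr₁₀b : r₁₀ ≤ (P₁₀ + q₁) * Y := by rw [hr₁₀]; nlinarith only [hBR₁₀, hB𝔮₁]
  have hr₁₁b : r₁₁ ≤ p₁₁ := by rw [hr₁₁, hR₁₁, ho₁₁e]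
  have hr₂₀b : r₂₀ ≤ (P₂₀ + 2 * P₁₀ * q₁ + q₂) * Y ^ 2 := by
    rw [hr₂₀]
    have t : R₁₀ * 𝔮₁ ≤ (P₁₀ * Y) * (q₁ * Y) := mul_le_mul hBR₁₀ hB𝔮₁ h𝔮₁0 (by positivity)
    nlinarith only [hBR₂₀, t, hB𝔮₂]
  have hr₂₁b : r₂₁ ≤ (P₂₁ + 2 * p₁₁ * q₁) * Y := by
    rw [hr₂₁, hR₁₁, ho₁₁e]
    have t : p₁₁ * 𝔮₁ ≤ p₁₁ * (q₁ * Y) := mul_le_mul_of_nonneg_left hB𝔮₁ hp₁₁0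
    nlinarith only [hBR₂₁, t]
  have hr₂₂b : r₂₂ ≤ p₂₂ := by rw [hr₂₂, hR₂₂, ho₂₂e]
  have hr₃₀b : r₃₀ ≤ (P₃₀ + 3 * P₂₀ * q₁ + 3 * P₁₀ * q₂ + q₃₀) * Y ^ 3 := by
    rw [hr₃₀]
    have t1 : R₂₀ * 𝔮₁ ≤ (P₂₀ * Y ^ 2) * (q₁ * Y) := mul_le_mul hBR₂₀ hB𝔮₁ h𝔮₁0 (by positivity)
    have t2 : R₁₀ * 𝔮₂ ≤ (P₁₀ * Y) * (q₂ * Y ^ 2) := mul_le_mul hBR₁₀ hB𝔮₂ h𝔮₂0 (by positivity)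
    nlinarith only [hBR₃₀, t1, t2, hB𝔮₃₀]
  have hr₃₁b : r₃₁ ≤ (P₃₁ + 3 * P₂₁ * q₁ + 3 * p₁₁ * q₂ + q₃₁) * Y ^ 2 := by
    rw [hr₃₁, hR₁₁, ho₁₁e]
    have t1 : R₂₁ * 𝔮₁ ≤ (P₂₁ * Y) * (q₁ * Y) := mul_le_mul hBR₂₁ hB𝔮₁ h𝔮₁0 (by positivity)
    have t2 : p₁₁ * 𝔮₂ ≤ p₁₁ * (q₂ * Y ^ 2) := mul_le_mul_of_nonneg_left hB𝔮₂ hp₁₁0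
    have t3 : 𝔮₃₁ ≤ q₃₁ * Y ^ 2 := hB𝔮₃₁.trans (mul_le_mul_of_nonneg_left hYY hq₃₁0)
    nlinarith only [hBR₃₁, t1, t2, t3]
  have hr₃₂b : r₃₂ ≤ (P₃₂ + 3 * p₂₂ * q₁) * Y := by
    rw [hr₃₂, hR₂₂, ho₂₂e]
    have t : p₂₂ * 𝔮₁ ≤ p₂₂ * (q₁ * Y) := mul_le_mul_of_nonneg_left hB𝔮₁ hp₂₂0
    nlinarith only [hBR₃₂, t]
  have hr₃₃b : r₃₃ ≤ p₃₃ := by rw [hr₃₃, hR₃₃, ho₃₃e]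
  -- one constant for all nine
  set Q : ℝ := (P₁₀ + q₁) + p₁₁ + (P₂₀ + 2 * P₁₀ * q₁ + q₂) + (P₂₁ + 2 * p₁₁ * q₁) + p₂₂ + (P₃₀ + 3 * P₂₀ * q₁ + 3 * P₁₀ * q₂ + q₃₀) +
      (P₃₁ + 3 * P₂₁ * q₁ + 3 * p₁₁ * q₂ + q₃₁) + (P₃₂ + 3 * p₂₂ * q₁) + p₃₃ with hQ
  have c1 : P₁₀ + q₁ ≤ Q := by rw [hQ]; nlinarith only [hq₁0, hq₂0, hq₃₀0, hq₃₁0, hp₁₁0, hp₂₂0, hp₃₃0, hP₁₀0, hP₂₀0, hP₂₁0, hP₃₀0, hP₃₁0, hP₃₂0]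
  have c2 : p₁₁ ≤ Q := by rw [hQ]; nlinarith only [hq₁0, hq₂0, hq₃₀0, hq₃₁0, hp₁₁0, hp₂₂0, hp₃₃0, hP₁₀0, hP₂₀0, hP₂₁0, hP₃₀0, hP₃₁0, hP₃₂0]
  have c3 : P₂₀ + 2 * P₁₀ * q₁ + q₂ ≤ Q := by rw [hQ]; nlinarith only [hq₁0, hq₂0, hq₃₀0, hq₃₁0, hp₁₁0, hp₂₂0, hp₃₃0, hP₁₀0, hP₂₀0, hP₂₁0, hP₃₀0, hP₃₁0, hP₃₂0]
  have c4 : P₂₁ + 2 * p₁₁ * q₁ ≤ Q := by rw [hQ]; nlinarith only [hq₁0, hq₂0, hq₃₀0, hq₃₁0, hp₁₁0, hp₂₂0, hp₃₃0, hP₁₀0, hP₂₀0, hP₂₁0, hP₃₀0, hP₃₁0, hP₃₂0]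
  have c5 : p₂₂ ≤ Q := by rw [hQ]; nlinarith only [hq₁0, hq₂0, hq₃₀0, hq₃₁0, hp₁₁0, hp₂₂0, hp₃₃0, hP₁₀0, hP₂₀0, hP₂₁0, hP₃₀0, hP₃₁0, hP₃₂0]
  have c6 : P₃₀ + 3 * P₂₀ * q₁ + 3 * P₁₀ * q₂ + q₃₀ ≤ Q := by rw [hQ]; nlinarith only [hq₁0, hq₂0, hq₃₀0, hq₃₁0, hp₁₁0, hp₂₂0, hp₃₃0, hP₁₀0, hP₂₀0, hP₂₁0, hP₃₀0, hP₃₁0, hP₃₂0]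
  have c7 : P₃₁ + 3 * P₂₁ * q₁ + 3 * p₁₁ * q₂ + q₃₁ ≤ Q := by rw [hQ]; nlinarith only [hq₁0, hq₂0, hq₃₀0, hq₃₁0, hp₁₁0, hp₂₂0, hp₃₃0, hP₁₀0, hP₂₀0, hP₂₁0, hP₃₀0, hP₃₁0, hP₃₂0]
  have c8 : P₃₂ + 3 * p₂₂ * q₁ ≤ Q := by rw [hQ]; nlinarith only [hq₁0, hq₂0, hq₃₀0, hq₃₁0, hp₁₁0, hp₂₂0, hp₃₃0, hP₁₀0, hP₂₀0, hP₂₁0, hP₃₀0, hP₃₁0, hP₃₂0]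
  have c9 : p₃₃ ≤ Q := by rw [hQ]; nlinarith only [hq₁0, hq₂0, hq₃₀0, hq₃₁0, hp₁₁0, hp₂₂0, hp₃₃0, hP₁₀0, hP₂₀0, hP₂₁0, hP₃₀0, hP₃₁0, hP₃₂0]
  exact ⟨hr₁₀b.trans (mul_le_mul_of_nonneg_right c1 hY0), hr₁₁b.trans c2, hr₂₀b.trans (mul_le_mul_of_nonneg_right c3 (by positivity)),
    hr₂₁b.trans (mul_le_mul_of_nonneg_right c4 hY0), hr₂₂b.trans c5, hr₃₀b.trans (mul_le_mul_of_nonneg_right c6 (by positivity)),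
    hr₃₁b.trans (mul_le_mul_of_nonneg_right c7 (by positivity)), hr₃₂b.trans (mul_le_mul_of_nonneg_right c8 hY0), hr₃₃b.trans c9⟩

end Summit.HubbardSuperconductivity.HubbardSuperconductivity.Theorems.TorusFourierL2

end
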